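import Summits.BirchSwinnertonDyer.BirchSwinnertonDyer.Theorems.SignedLowerHalvesSmallImageLowerHalfBothSignsRttD2SeqSemilocFrobSmul
import Summits.BirchSwinnertonDyer.BirchSwinnertonDyer.Theorems.SignedLowerHalvesSmallImageLowerHalfBothSignsRttD2SeqSemilocCoindFrob
import Summits.BirchSwinnertonDyer.BirchSwinnertonDyer.Theorems.SignedLowerHalvesSmallImageLowerHalfBothSignsRttD2SeqSemilocMuGenerators
import HarnessLib

/-!
# Route `SignedLowerHalves`, crux L `SmallImageLowerHalfBothSigns` (stmt-BirchSwinnertonDyer-23599), line `rtt_w3` v32 — stub S3β″ (`stub_junctionPT_ns`), input N5-(iii):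
# ★★★ THE UNRAMIFIED GENERATOR `u_w ∈ 𝐇¹_{Iw,w}` WITH EXACT ANNIHILATOR `Ann_{Λ_𝒪}(u_w) = (P_w)`, `P_w = (1+T)^{x_w} − C(θ′(φ_w)χ_cyc(φ_w))`

WIDTH seat `bsd-line-slh-p3-w3` g27 under LEAD `cruxlead-stmt-BirchSwinnertonDyer-23599` g14 (cell `bsd-ssimc`); helper `--supports stmt-BirchSwinnertonDyer-23599`
(plan `Lines/rtt_w3-DESIGN-N5iii-w3-g26.md` §2 C1–C7, assembled). THEOREMS ONLY (no definition, no named fact, no instance, no `sorry`). HONEST FRAMING: this is the hypothesis `hgen`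
of g26's `lambdaInvariant_quotient_span_le_unramifiedFamilies_of_generators` (p818109) — the LAST local input of S3β″ — PROVED at every place `w ∉ P` with a Frobenius lift `φ̃` and
exponent `x` (`γ^{x mod pⁿ} φ_w⁻¹ ∈ U_n`): the level classes `u_{n,k}` = the unramified classes with Frobenius value `δ_1 ⊗ (1 ⊗ ζ_k)` (compatible generators `ζ_k`, g27
`…SemilocMuGenerators`) are compatible under corestriction and reduction (naturality of the Frobenius value, g27 `…SemilocFrobLevel`), lift to `u_w` by pin (P4), are unramified, and
`f • u_{n,k} = 0 ↔ f ∈ (p^k, ω_n, P_w)` (g27 `isFrobValue_smul` + `smul_mkQ_coindFrob_single_one_eq_zero_iff`), whence `Ann(u_w) = ⋂_{n,k} (p^k, ω_n, P_w) = (P_w)` (g26 Krull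
`iInf_iInf_sup_span_pair_eq`). §3 packages it on the skeleton's Γ-binders. Nothing about S3β″, crux L or BSD is asserted here beyond this local generator; all remain OPEN and are proved
for NO curve.
References: [SerreLocalFields1979] XIII §1 Prop. 1; [MilneADT2006] I §2 Lemma 2.9; [PerrinRiou1994Invent] §1.3; [Rubin2000] App. B.3; [Washington1997] §13.2; [Lang1990] Ch. 5 §1.
-/

set_option autoImplicit false
set_option linter.dupNamespace false -- D-0017: single-problem summit, the namespace repeats the problem name by design
noncomputable section

open scoped Classical PowerSeries
open NumberField IsDedekindDomain Field CategoryTheory Function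

namespace Summit.BirchSwinnertonDyer.BirchSwinnertonDyer.Theorems.SmallImageRttD2Seq

open Literature.NumberTheory.EllipticCurves Literature.NumberTheory.GaloisRepresentations
  Literature.NumberTheory.GaloisRepresentations.DiscreteGaloisModule
  Literature.NumberTheory.ComplexMultiplication.EllipticUnits Literature.NumberTheory.ComplexMultiplication.EllipticUnits.JohnsonLeungKings2011
  Summit.BirchSwinnertonDyer.BirchSwinnertonDyer.Theorems.SmallImageRttD2J1
  IsDedekindDomain.HeightOneSpectrum

/-! ## §1. The annihilator of the level generator `u_{n,k}` -/

section Level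

variable {K : Type} [Field K] [NumberField K] {p : ℕ} [Fact p.Prime] (S : Set (PadicAlgCl p)) [FiniteDimensional ℚ_[p] (padicCoeffField S)] (κ : ZpExtension K p)
  (γ : absoluteGaloisGroup K) (θ' : absoluteGaloisGroup K →ₜ* (padicCoeffIntegers S)ˣ) (P : Set (HeightOneSpectrum (𝓞 K))) (w : HeightOneSpectrum (𝓞 K))

set_option maxHeartbeats 1600000 in
/-- ★★ **`f • u_{n,k} = 0 ↔ f ∈ (p^k, ω_n) + (P_w)`** for the unramified class `u_{n,k} ∈ Lloc_w(n,k)` with Frobenius value `δ_1 ⊗ (1⊗ζ₀)` (at `w ∉ P`, `φ̃` a Frobenius lift, `γ^{x mod pⁿ} (res φ̃)⁻¹ ∈ U_n`,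
`ζ₀` a generator of `μ_{p^k}` of exact order): `f • u_{n,k}` has value `f • b₀` (C4), which lies in `(φ̃ − 1)·Maps(Γ_K ⧸ U_n, X_k)` iff `f ∈ Ann([b₀]) = (p^k, ω_n, P_w)` (C5).
[cite: SerreLocalFields1979, XIII §1 Prop. 1] [cite: Washington1997, §13.2] [cite: Lang1990, Ch. 5 §1] -/
theorem smul_frobGen_eq_zero_iff (hw : w ∉ P) (hNP : ∀ n, ramificationSubgroup K P ≤ κ.layerSubgroup n) {n k : ℕ} {φl : absoluteGaloisGroup (w.adicCompletion K)}
    (hφl : IsFrobPow φl 1) {a : ℤ_[p]ˣ} (hγ : (κ γ).toAdd = a) (hθN : ∀ g ∈ ramificationSubgroup K P, θ' g = 1)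
    (hμN : ∀ g ∈ ramificationSubgroup K P, ∀ ζ : MuCarrier K (p ^ k), mu K (p ^ k) g ζ = ζ)
    {e : MuCarrier K (p ^ k) ≃+ ZMod (p ^ k)} {ζ₀ : MuCarrier K (p ^ k)} (he : e ζ₀ = 1) (hζ₀ : ∀ ζ : MuCarrier K (p ^ k), ∃ m : ℤ, ζ = m • ζ₀)
    (hord : ∀ m : ℤ, m • ζ₀ = 0 ↔ ((p ^ k : ℕ) : ℤ) ∣ m) {x : ℤ_[p]}
    (hx : γ ^ (PadicInt.toZModPow n x).val * (resGalOfEmb (closureEmb (K := K) (w.adicCompletion K)) φl)⁻¹ ∈ κ.layerSubgroup n) {c : semilocCoh S κ θ' P w n k 1}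
    (hc : IsFrobValue (semilocGalRep S κ θ' P w n k) φl c (coindSingle S κ θ' P n k 1 ⟨OMuCarrier.tmul 1 ζ₀, mem_invariants_muTwistO_of_forall S θ' P k hθN hμN _⟩))
    (f : IwasawaAlgebraO S) :
    (letI := semilocLayerModuleΛ S κ γ θ' P w n k 1; f • c = 0) ↔
      f ∈ Ideal.span {PowerSeries.C (((p : ℕ) : padicCoeffIntegers S) ^ k), omegaT S n} ⊔
        Ideal.span {iwasawaToIwasawaO S (PowerSeries.binomialSeries ℤ_[p] x) -
          PowerSeries.C (((θ' (resGalOfEmb (closureEmb (K := K) (w.adicCompletion K)) φl) : (padicCoeffIntegers S)ˣ) : padicCoeffIntegers S) *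
            padicIntToCoeffIntegers S ((GaloisRep.cyclotomicCharacter K p (resGalOfEmb (closureEmb (K := K) (w.adicCompletion K)) φl) : ℤ_[p]ˣ) : ℤ_[p]))} := by
  letI jΛ := coindModuleΛ S κ γ θ' P n k
  have hval := isFrobValue_smul S κ γ θ' P w hw hNP hφl f hc
  refine (isFrobValue_semiloc_eq_iff S κ θ' P w hw hNP hφl hval IsFrobValue.zero).trans ?_
  rw [← smul_mkQ_coindFrob_single_one_eq_zero_iff S κ γ θ' P n k hγ hθN hμN he hζ₀ hord hx f, ← map_smul, Submodule.mkQ_apply, Submodule.Quotient.mk_eq_zero,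
    LinearMap.mem_range, sub_zero]
  constructor
  · rintro ⟨y, hy⟩
    exact ⟨y, hy.symm⟩
  · rintro ⟨y, hy⟩
    exact ⟨y, hy.symm⟩

end Level

/-! ## §2. Compatibility of the level generators `δ_1 ⊗ (1 ⊗ ζ_k)` under the fibre sum and the reduction -/

section Compat

variable {K : Type} [Field K] {p : ℕ} [Fact p.Prime] (S : Set (PadicAlgCl p)) (κ : ZpExtension K p)
  (θ' : absoluteGaloisGroup K →ₜ* (padicCoeffIntegers S)ˣ) (P : Set (HeightOneSpectrum (𝓞 K)))

/-- **The fibre sum fixes `δ_1 ⊗ ξ`**: `Σ_{U_{n+1} → U_n} (δ_1 ⊗ ξ) = δ_1 ⊗ ξ`. [cite: NeukirchSchmidtWingberg2008, I §5 Prop. (1.5.4)] -/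
theorem coindFinSum_coindSingle_one (n k : ℕ) (ξ : (coeffRepK S θ' P k).toTopRep) :
    (letI := layerQuotFintype κ (n + 1); (coindFinSum (coeffRepK S θ' P k).toTopRep (κ.layerSubgroup_antitone (Nat.le_succ n))).hom (coindSingle S κ θ' P (n + 1) k 1 ξ)) =
      coindSingle S κ θ' P n k 1 ξ := by
  letI := layerQuotFintype κ (n + 1)
  refine funext fun y ↦ ?_
  rw [coindFinSum_apply, Finset.sum_eq_single (1 : absoluteGaloisGroup K ⧸ κ.layerSubgroup (n + 1))]
  · rw [coindSingle_apply_self, show Subgroup.quotientMapOfLE (κ.layerSubgroup_antitone (Nat.le_succ n)) (1 : absoluteGaloisGroup K ⧸ κ.layerSubgroup (n + 1)) = 1 from rfl]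
    by_cases hy : y = 1
    · subst hy; rw [if_pos rfl, coindSingle_apply_self]
    · rw [if_neg (Ne.symm hy), coindSingle_apply_of_ne S κ θ' P n k hy]
  · intro z _ hz
    rw [coindSingle_apply_of_ne S κ θ' P (n + 1) k hz, ite_self]
  · intro h
    exact absurd (Finset.mem_univ _) h

/-- **The reduction of `δ_1 ⊗ (1 ⊗ ζ_{k+1})` is `δ_1 ⊗ (1 ⊗ ζ_{k+1}^p)`.** [cite: Kato2004Asterisque, §8.2 (p. 180)] -/
theorem coeffMapO_oMuRed_comp_coindSingle_one (n k : ℕ) (ξ : (coeffRepK S θ' P (k + 1)).toTopRep) :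
    (fun y ↦ coeffMapO S P θ' (oMuRed S k) (oMuRed_muTwistO S θ' k) (coindSingle S κ θ' P n (k + 1) 1 ξ y)) =
      coindSingle S κ θ' P n k 1 (coeffMapO S P θ' (oMuRed S k) (oMuRed_muTwistO S θ' k) ξ) := by
  refine funext fun y ↦ ?_
  by_cases hy : y = 1
  · subst hy; rw [coindSingle_apply_self, coindSingle_apply_self]
  · rw [coindSingle_apply_of_ne S κ θ' P n (k + 1) hy, coindSingle_apply_of_ne S κ θ' P n k hy, map_zero]

end Compat

/-! ## §3. The unramified generator -/

section Gen

variable {K : Type} [Field K] [NumberField K] {p : ℕ} [Fact p.Prime] (S : Set (PadicAlgCl p)) [FiniteDimensional ℚ_[p] (padicCoeffField S)] (κ : ZpExtension K p)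
  (γ : absoluteGaloisGroup K) (θ' : absoluteGaloisGroup K →ₜ* (padicCoeffIntegers S)ˣ) (P : Set (HeightOneSpectrum (𝓞 K))) (w : HeightOneSpectrum (𝓞 K))

set_option maxHeartbeats 1600000 in
/-- ★★★ **THE UNRAMIFIED GENERATOR WITH EXACT ANNIHILATOR.** At a place `w ∉ P` of `K` (inertia `≤ N_P ≤ U_n`, `θ′|_{N_P} = 1`, `N_P` fixing `μ_{p^∞}`), for `γ` with `κ γ` a unit, a Frobenius
lift `φ̃ ∈ Γ_{K_w}` and an exponent `x ∈ ℤ_p` with `γ^{x mod pⁿ} (res φ̃)⁻¹ ∈ U_n` for all `n`: there is `u ∈ 𝐇¹_{Iw,w}` (the constructed semilocal datum) all of whose level projections are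
UNRAMIFIED and whose annihilator is EXACTLY `(P)`, `P = (1+T)^x − C(θ′(res φ̃)·χ_cyc(res φ̃))`. Levels: the unramified classes with Frobenius value `δ_1 ⊗ (1 ⊗ ζ_k)` for compatible generators `ζ_k`;
compatibility by naturality; `Ann = ⋂_{n,k} (p^k, ω_n, P) = (P)` by Krull. [cite: SerreLocalFields1979, XIII §1 Prop. 1] [cite: PerrinRiou1994Invent, §1.3] [cite: Rubin2000, App. B.3]
[cite: Washington1997, §13.2] -/
theorem exists_unramified_generator (hw : w ∉ P) (hNP : ∀ n, ramificationSubgroup K P ≤ κ.layerSubgroup n) {a : ℤ_[p]ˣ} (hγ : (κ γ).toAdd = a)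
    (hθN : ∀ g ∈ ramificationSubgroup K P, θ' g = 1) (hμN : ∀ k : ℕ, ∀ g ∈ ramificationSubgroup K P, ∀ ζ : MuCarrier K (p ^ k), mu K (p ^ k) g ζ = ζ)
    {φl : absoluteGaloisGroup (w.adicCompletion K)} (hφl : IsFrobPow φl 1) {x : ℤ_[p]}
    (hx : ∀ n : ℕ, γ ^ (PadicInt.toZModPow n x).val * (resGalOfEmb (closureEmb (K := K) (w.adicCompletion K)) φl)⁻¹ ∈ κ.layerSubgroup n) :
    ∃ u : (semilocIwasawaCohomologyDataO S κ γ θ' P w 1).H,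
      (∀ f : IwasawaAlgebraO S, f • u = 0 ↔ f ∈ Ideal.span {iwasawaToIwasawaO S (PowerSeries.binomialSeries ℤ_[p] x) -
          PowerSeries.C (((θ' (resGalOfEmb (closureEmb (K := K) (w.adicCompletion K)) φl) : (padicCoeffIntegers S)ˣ) : padicCoeffIntegers S) *
            padicIntToCoeffIntegers S ((GaloisRep.cyclotomicCharacter K p (resGalOfEmb (closureEmb (K := K) (w.adicCompletion K)) φl) : ℤ_[p]ˣ) : ℤ_[p]))}) ∧
      ∀ n k : ℕ, (semilocIwasawaCohomologyDataO S κ γ θ' P w 1).proj n k u ∈ unramifiedLevelΛ S κ γ θ' P w n k := by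
  -- compatible generators `ζ_k` and the level coefficients `b_{n,k} = δ_1 ⊗ (1 ⊗ ζ_k)`
  obtain ⟨ζ, hζgen, hζcompat⟩ := exists_compatible_generators K (p := p)
  choose e he using hζgen
  have hgen : ∀ k, (∀ ζ' : MuCarrier K (p ^ k), ∃ m : ℤ, ζ' = m • ζ k) ∧ ∀ m : ℤ, m • ζ k = 0 ↔ ((p ^ k : ℕ) : ℤ) ∣ m :=
    fun k ↦ generator_of_equiv_apply_eq_one K k (e k) (he k)
  let ξ : ∀ k : ℕ, (coeffRepK S θ' P k).toTopRep := fun k ↦ ⟨OMuCarrier.tmul 1 (ζ k), mem_invariants_muTwistO_of_forall S θ' P k hθN (hμN k) _⟩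
  have hξred : ∀ k, coeffMapO S P θ' (oMuRed S k) (oMuRed_muTwistO S θ' k) (ξ (k + 1)) = ξ k := fun k ↦
    Subtype.ext (by change oMuRed S k (OMuCarrier.tmul 1 (ζ (k + 1))) = OMuCarrier.tmul 1 (ζ k); rw [oMuRed_tmul, hζcompat])
  -- the level classes
  have hex : ∀ n k : ℕ, ∃ c : semilocCoh S κ θ' P w n k 1, IsFrobValue (semilocGalRep S κ θ' P w n k) φl c (coindSingle S κ θ' P n k 1 (ξ k)) :=
    fun n k ↦ exists_isFrobValue_semiloc S κ θ' P w hw hNP n k hφl _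
  choose c hc using hex
  have hcores : ∀ n k, semilocCores S κ θ' P w n k 1 (c (n + 1) k) = c n k := fun n k ↦
    isFrobValue_semiloc_eq_of_eq S κ θ' P w hw hNP hφl
      ((coindFinSum_coindSingle_one S κ θ' P n k (ξ k)) ▸ isFrobValue_semilocCores S κ θ' P w φl (hc (n + 1) k)) (hc n k)
  have hred : ∀ n k, semilocRed S κ θ' P w n k 1 (c n (k + 1)) = c n k := fun n k ↦
    isFrobValue_semiloc_eq_of_eq S κ θ' P w hw hNP hφl
      ((hξred k) ▸ (coeffMapO_oMuRed_comp_coindSingle_one S κ θ' P n k (ξ (k + 1))) ▸ isFrobValue_semilocRed S κ θ' P w φl (hc n (k + 1))) (hc n k)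
  -- the lift
  obtain ⟨u, hu⟩ := (semilocIwasawaCohomologyDataO S κ γ θ' P w 1).proj_surjective c hcores hred
  refine ⟨u, fun f ↦ ?_, fun n k ↦ (hu n k) ▸ mem_unramifiedLevelΛ_of_isFrobValue S κ θ' P w γ hw hNP φl (hc n k)⟩
  -- the annihilator, levelwise, then Krull
  rw [← iInf_iInf_sup_span_pair_eq S (Ideal.span {iwasawaToIwasawaO S (PowerSeries.binomialSeries ℤ_[p] x) -
      PowerSeries.C (((θ' (resGalOfEmb (closureEmb (K := K) (w.adicCompletion K)) φl) : (padicCoeffIntegers S)ˣ) : padicCoeffIntegers S) *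
        padicIntToCoeffIntegers S ((GaloisRep.cyclotomicCharacter K p (resGalOfEmb (closureEmb (K := K) (w.adicCompletion K)) φl) : ℤ_[p]ˣ) : ℤ_[p]))}),
    Ideal.mem_iInf]
  simp only [Ideal.mem_iInf]
  constructor
  · intro hf n k
    have h0 : (semilocIwasawaCohomologyDataO S κ γ θ' P w 1).proj n k (f • u) = 0 := by rw [hf, map_zero]
    rw [proj_semilocIwasawaCohomologyDataO_smul, hu n k, smul_frobGen_eq_zero_iff S κ γ θ' P w hw hNP hφl hγ hθN (hμN k) (he k) (hgen k).1 (hgen k).2 (hx n) (hc n k)] at h0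
    rwa [sup_comm]
  · intro hf
    refine (semilocIwasawaCohomologyDataO S κ γ θ' P w 1).proj_injective _ fun n k ↦ ?_
    rw [proj_semilocIwasawaCohomologyDataO_smul, hu n k, smul_frobGen_eq_zero_iff S κ γ θ' P w hw hNP hφl hγ hθN (hμN k) (he k) (hgen k).1 (hgen k).2 (hx n) (hc n k), sup_comm]
    exact hf n k

end Gen

end Summit.BirchSwinnertonDyer.BirchSwinnertonDyer.Theorems.SmallImageRttD2Seq

end
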